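import Summits.Ventures.DiscreteObjects.PP12.FixedPointsEqFixedLines
import Literature.Combinatorics.Designs.DifferenceSetMultiplier

/-!
# PP(n): a point- and line-regular cyclic collineation group gives a planar difference set (Singer's correspondence, kernel)
Framing: lottery ticket; floor = certified bounds/negative ranges.

Cell `pub-namedobj`, target M (projective plane of order 12), family B2 / control B2 ('no cyclic plane of order 12').
For a collineation `σ` of a finite projective plane (Mathlib `Configuration.ProjectivePlane`, the cell's
`Collineation` structure) we prove:

* `mem_iff_zpow` — integer powers of a collineation preserve incidence (from `pow_mem_iff`, `PrimeOrderStructure`);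
* **`exists_differenceSet_of_regular`** — if the plane has `v` points, `σ ^ v = 1` on points and on lines, and no
  power `σ ^ m` (`0 < m < v`) fixes a point or a line (so `⟨σ⟩ ≅ ℤ/v` acts regularly on points and on lines), then
  `D = {i ∈ ℤ/v : σ^i x₀ ∈ l₀}` is a planar difference set: `IsDifferenceSet D 1` (Literature
  `DifferenceSetMultiplier`) with `|D| = n + 1`. This is the necessity half of Singer's correspondence
  'cyclic planes ↔ planar difference sets' (Hall 1947; Lander 1983 Thm. 4.2), written for the abstract plane; the
  sufficiency half is Literature `DifferenceSetDevelopment` (`IsDifferenceSet.projectivePlane`).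

Proof: index points and lines by `ℤ` through `i ↦ σ^i x₀`, `j ↦ σ^j l₀`; a power with a fixed point is a multiple of
`v`; incidence is `σ^i x₀ ∈ σ^j l₀ ↔ σ^(i-j) x₀ ∈ l₀`; descend to `ZMod v` (both index maps are bijections by
counting); the representations `g = a - b` in `D` of `g ≠ 0` correspond to the lines through the two distinct
points `σ^g x₀`, `x₀`, of which there is exactly one. Everything is proved; no `sorry`, no new axioms. Used by
`NoOrder157.lean` (no collineation of order 157 on a plane of order 12).
-/

namespace Summit.Ventures.DiscreteObjects.PP12

open Configuration Finset
open Literature.Combinatorics.Designs.DifferenceSets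

namespace Collineation

section General

variable {P L : Type*} [Membership P L] (σ : Collineation P L)

/-- Integer powers of a collineation preserve incidence. -/
theorem mem_iff_zpow (n : ℤ) (p : P) (l : L) : (σ.onPoints ^ n) p ∈ (σ.onLines ^ n) l ↔ p ∈ l := by
  cases n with
  | ofNat n => simpa using σ.pow_mem_iff n p l
  | negSucc n =>
    rw [zpow_negSucc, zpow_negSucc]
    have := σ.pow_mem_iff (n + 1) ((σ.onPoints ^ (n + 1))⁻¹ p) ((σ.onLines ^ (n + 1))⁻¹ l)
    simp only [Equiv.Perm.coe_inv, Equiv.apply_symm_apply] at this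
    exact this.symm

end General

section Plane

variable {P L : Type*} [Membership P L] [ProjectivePlane P L] [Fintype P] [Fintype L]
  [DecidableEq P] [DecidableEq L] (σ : Collineation P L)

omit [DecidableEq L] in
/-- no fixed points when `fixedCard = 0` -/
theorem ne_of_fixedCard_eq_zero {τ : Equiv.Perm P} (h : fixedCard τ = 0) (x : P) : τ x ≠ x := by
  intro hx
  unfold fixedCard at h
  rw [Finset.card_eq_zero] at h
  have : x ∈ (univ.filter fun y : P => τ y = y) := by simp [hx]
  rw [h] at this
  exact absurd this (Finset.notMem_empty x)

/-- **From a point- and line-regular cyclic collineation group to a planar difference set.**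
Let `σ` be a collineation of a finite projective plane of order `n` with `v` points such that `σ ^ v = 1` on points
and on lines and no power `σ ^ m`, `0 < m < v`, fixes a point or a line. Then the set of exponents `i` with
`σ^i x₀ ∈ l₀` is a planar `(v, n + 1, 1)` difference set in `ZMod v` (Singer's correspondence, necessity
direction). -/
theorem exists_differenceSet_of_regular (v : ℕ) [NeZero v] (hv : Fintype.card P = v)
    (hσP : σ.onPoints ^ v = 1) (hσL : σ.onLines ^ v = 1)
    (hP : ∀ m : ℕ, 0 < m → m < v → ∀ x : P, (σ.onPoints ^ m) x ≠ x)
    (hL : ∀ m : ℕ, 0 < m → m < v → ∀ l : L, (σ.onLines ^ m) l ≠ l) :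
    ∃ D : Finset (ZMod v), IsDifferenceSet D 1 ∧ D.card = ProjectivePlane.order P L + 1 := by
  classical
  have hvpos : 0 < v := Nat.pos_of_ne_zero (NeZero.ne v)
  have hvL : Fintype.card L = v := by rw [← ProjectivePlane.card_points_eq_card_lines P L]; exact hv
  -- base point and base line
  have hPn : Nonempty P := by rw [← Fintype.card_pos_iff, hv]; exact hvpos
  obtain ⟨x₀⟩ := hPn
  have hLn : Nonempty L := by rw [← Fintype.card_pos_iff, hvL]; exact hvpos
  obtain ⟨l₀⟩ := hLn
  -- integer-indexed orbits
  set ptZ : ℤ → P := fun i => (σ.onPoints ^ i) x₀ with hptZ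
  set lnZ : ℤ → L := fun j => (σ.onLines ^ j) l₀ with hlnZ
  -- (a) generic divisibility lemma: a power with a fixed point/line is a multiple of v
  have keyP : ∀ i : ℤ, (∃ x, (σ.onPoints ^ i) x = x) → (v : ℤ) ∣ i := by
    rintro i ⟨x, hx⟩
    have hr0 : 0 ≤ i % v := Int.emod_nonneg _ (by exact_mod_cast hvpos.ne')
    have hrv : i % v < v := Int.emod_lt_of_pos _ (by exact_mod_cast hvpos)
    rw [zpow_eq_zpow_emod' i hσP] at hx
    obtain ⟨r, hr⟩ : ∃ r : ℕ, (i % v : ℤ) = r := ⟨(i % v).toNat, (Int.toNat_of_nonneg hr0).symm⟩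
    rw [hr, zpow_natCast] at hx
    have hrv' : r < v := by exact_mod_cast (hr ▸ hrv)
    by_cases hr0' : r = 0
    · subst hr0'
      exact Int.dvd_of_emod_eq_zero (by exact_mod_cast hr)
    · exact absurd hx (hP r (Nat.pos_of_ne_zero hr0') hrv' x)
  have keyL : ∀ j : ℤ, (∃ l, (σ.onLines ^ j) l = l) → (v : ℤ) ∣ j := by
    rintro j ⟨l, hl⟩
    have hr0 : 0 ≤ j % v := Int.emod_nonneg _ (by exact_mod_cast hvpos.ne')
    have hrv : j % v < v := Int.emod_lt_of_pos _ (by exact_mod_cast hvpos)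
    rw [zpow_eq_zpow_emod' j hσL] at hl
    obtain ⟨r, hr⟩ : ∃ r : ℕ, (j % v : ℤ) = r := ⟨(j % v).toNat, (Int.toNat_of_nonneg hr0).symm⟩
    rw [hr, zpow_natCast] at hl
    have hrv' : r < v := by exact_mod_cast (hr ▸ hrv)
    by_cases hr0' : r = 0
    · subst hr0'
      exact Int.dvd_of_emod_eq_zero (by exact_mod_cast hr)
    · exact absurd hl (hL r (Nat.pos_of_ne_zero hr0') hrv' l)
  -- (b) well-definedness modulo v
  have ptZ_eq : ∀ i j : ℤ, (v : ℤ) ∣ i - j → ptZ i = ptZ j := by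
    rintro i j ⟨t, ht⟩
    have : i = j + v * t := by linarith
    simp only [hptZ, this, zpow_add, zpow_mul, zpow_natCast, hσP, one_zpow, mul_one]
  have lnZ_eq : ∀ i j : ℤ, (v : ℤ) ∣ i - j → lnZ i = lnZ j := by
    rintro i j ⟨t, ht⟩
    have : i = j + v * t := by linarith
    simp only [hlnZ, this, zpow_add, zpow_mul, zpow_natCast, hσL, one_zpow, mul_one]
  -- (c) injectivity modulo v
  have ptZ_inj : ∀ i j : ℤ, ptZ i = ptZ j → (v : ℤ) ∣ i - j := by
    intro i j hij
    apply keyP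
    refine ⟨x₀, ?_⟩
    have : (σ.onPoints ^ (-j)) ((σ.onPoints ^ i) x₀) = (σ.onPoints ^ (-j)) ((σ.onPoints ^ j) x₀) := by
      simp only [hptZ] at hij; rw [hij]
    rwa [← Equiv.Perm.mul_apply, ← Equiv.Perm.mul_apply, ← zpow_add, ← zpow_add, neg_add_cancel, zpow_zero,
      Equiv.Perm.one_apply, neg_add_eq_sub] at this
  have lnZ_inj : ∀ i j : ℤ, lnZ i = lnZ j → (v : ℤ) ∣ i - j := by
    intro i j hij
    apply keyL
    refine ⟨l₀, ?_⟩
    have : (σ.onLines ^ (-j)) ((σ.onLines ^ i) l₀) = (σ.onLines ^ (-j)) ((σ.onLines ^ j) l₀) := by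
      simp only [hlnZ] at hij; rw [hij]
    rwa [← Equiv.Perm.mul_apply, ← Equiv.Perm.mul_apply, ← zpow_add, ← zpow_add, neg_add_cancel, zpow_zero,
      Equiv.Perm.one_apply, neg_add_eq_sub] at this
  -- (d) incidence along the orbits: `σ^i x₀ ∈ σ^j l₀ ↔ σ^(i-j) x₀ ∈ l₀`
  have inc : ∀ i j : ℤ, ptZ i ∈ lnZ j ↔ ptZ (i - j) ∈ l₀ := by
    intro i j
    have h := σ.mem_iff_zpow (-j) ((σ.onPoints ^ i) x₀) ((σ.onLines ^ j) l₀)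
    rw [← Equiv.Perm.mul_apply, ← Equiv.Perm.mul_apply, ← zpow_add, ← zpow_add, neg_add_cancel, zpow_zero,
      Equiv.Perm.one_apply, neg_add_eq_sub] at h
    exact h.symm
  -- (e) descend to `ZMod v`
  set pt : ZMod v → P := fun a => ptZ (a.val : ℤ) with hpt
  set ln : ZMod v → L := fun a => lnZ (a.val : ℤ) with hln
  have pt_cast : ∀ z : ℤ, ptZ z = pt (z : ZMod v) := by
    intro z
    apply ptZ_eq
    rw [ZMod.val_intCast]
    exact Int.dvd_self_sub_emod
  have pt_inj : Function.Injective pt := by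
    intro a b hab
    have h := ptZ_inj _ _ hab
    have : ((a.val : ℤ) : ZMod v) = ((b.val : ℤ) : ZMod v) := by
      rw [ZMod.intCast_eq_intCast_iff_dvd_sub]
      have := Int.dvd_neg.mpr h
      rwa [neg_sub] at this
    simpa [ZMod.natCast_zmod_val] using this
  have ln_inj : Function.Injective ln := by
    intro a b hab
    have h := lnZ_inj _ _ hab
    have : ((a.val : ℤ) : ZMod v) = ((b.val : ℤ) : ZMod v) := by
      rw [ZMod.intCast_eq_intCast_iff_dvd_sub]
      have := Int.dvd_neg.mpr h
      rwa [neg_sub] at this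
    simpa [ZMod.natCast_zmod_val] using this
  have pt_bij : Function.Bijective pt := by
    rw [Fintype.bijective_iff_injective_and_card]
    exact ⟨pt_inj, by rw [ZMod.card, hv]⟩
  have ln_bij : Function.Bijective ln := by
    rw [Fintype.bijective_iff_injective_and_card]
    exact ⟨ln_inj, by rw [ZMod.card, hvL]⟩
  -- the difference set
  set D : Finset (ZMod v) := univ.filter fun a => pt a ∈ l₀ with hDdef
  have incZ : ∀ a b : ZMod v, pt a ∈ ln b ↔ a - b ∈ D := by
    intro a b
    simp only [hDdef, mem_filter, mem_univ, true_and]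
    show ptZ _ ∈ lnZ _ ↔ _
    rw [inc, pt_cast, Int.cast_sub, Int.cast_natCast, Int.cast_natCast, ZMod.natCast_zmod_val,
      ZMod.natCast_zmod_val]
  refine ⟨D, ?_, ?_⟩
  · -- difference set with λ = 1
    intro g hg
    have hne : pt g ≠ pt 0 := fun h => hg (pt_inj h)
    -- `{b ∈ D | g + b ∈ D}` is the image under `j ↦ -j` of the lines through `pt g` and `pt 0`
    have hset : (D.filter fun b => g + b ∈ D) =
        (univ.filter fun j : ZMod v => pt g ∈ ln j ∧ pt 0 ∈ ln j).image fun j => -j := by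
      ext b
      simp only [mem_filter, mem_image, mem_univ, true_and]
      constructor
      · rintro ⟨hb, hgb⟩
        refine ⟨-b, ⟨?_, ?_⟩, neg_neg b⟩
        · rw [incZ, sub_neg_eq_add]; exact hgb
        · rw [incZ, zero_sub, neg_neg]
          simp only [hDdef, mem_filter, mem_univ, true_and] at hb; simpa [hDdef] using hb
      · rintro ⟨j, ⟨hgj, h0j⟩, rfl⟩
        rw [incZ, zero_sub] at h0j
        rw [incZ, sub_eq_add_neg] at hgj
        exact ⟨h0j, hgj⟩
    rw [hset, Finset.card_image_of_injective _ neg_injective]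
    -- transport along the bijection `ln`
    have htrans : (univ.filter fun j : ZMod v => pt g ∈ ln j ∧ pt 0 ∈ ln j).card =
        (univ.filter fun l : L => pt g ∈ l ∧ pt 0 ∈ l).card := by
      rw [← Finset.card_image_of_injective _ ln_inj]
      congr 1
      ext l
      simp only [mem_image, mem_filter, mem_univ, true_and]
      constructor
      · rintro ⟨j, hj, rfl⟩; exact hj
      · intro hl
        obtain ⟨j, rfl⟩ := ln_bij.2 l
        exact ⟨j, hl, rfl⟩
    rw [htrans, card_common_lines, if_neg hne]
  · -- `|D| = n + 1`
    have : D.image pt = univ.filter fun p : P => p ∈ l₀ := by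
      ext p
      simp only [mem_image, hDdef, mem_filter, mem_univ, true_and]
      constructor
      · rintro ⟨a, ha, rfl⟩; exact ha
      · intro hp
        obtain ⟨a, rfl⟩ := pt_bij.2 p
        exact ⟨a, hp, rfl⟩
    rw [← Finset.card_image_of_injective D pt_inj, this, ← Fintype.card_subtype, ← Nat.card_eq_fintype_card]
    exact ProjectivePlane.pointCount_eq P l₀

end Plane

end Collineation

end Summit.Ventures.DiscreteObjects.PP12
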